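import Mathlib
import HarnessLib
import HarnessLib.Audit
import Summits.SmoothPoincare4.Statement
import Literature.Topology.FourManifolds.MMSWRasmussen
import Literature.Topology.FourManifolds.MMSWRasmussenFacts
import Literature.Topology.FourManifolds.MMSWTowerAdjunction
import HarnessLib.Audit.Status.Attr

/-!
Route: DottedCircleRasmussen

DORMANT since 2026-08-24T21:38:30Z (reconciler: no traction for 7.1 d (last activity item-evidence-added at 2026-08-17T18:47:21Z); parked, not closed — `ledger route dormant route-SmoothPoincare4-DottedCircleRasmussen --off` to reactiva) — unstaffed, not closed; items shared with open routes are served there. `ledger route dormant <id> --off` reactivates.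

NEGATIVE-SIDE route (refutation form of the deciding theorem; lens = negation). It suffices to show
X = ONE-HANDLE SLICE GAP (item DcrGap):
there are a smooth homotopy 4-sphere Σ (literally the Statement's binders: M : Type, Hausdorff,
second countable, a C^∞ atlas on ℝ⁴, M ≃ₕ S⁴),
a number k, a smooth embedding e : ℝ⁴ → Σ, and a smoothly embedded circle K₀ in the boundary of the
MODEL DOTTED HANDLEBODY
D_k = {(z,w) ∈ ℂ² = ℝ⁴ : |z|²/(40(k+1))² + Σ_{j<k} 1/|z − 4(j+1)|² + |w|² ≤ 1} (a smooth compact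
domain ≅ ♮ᵏ(S¹×B³): a 4-ball with k flat proper
2-discs {z = 4(j+1)} carved out — the dotted-circle picture of a 0-handle and k 1-handles; ∂D_k ≅
#ᵏ(S¹×S²)), such that e∘K₀ bounds a smooth properly
embedded disc in Σ ∖ e(D_k), while in NO smooth 4-manifold N diffeomorphic to S⁴ (any carrier and
atlas) and for no smooth embedding e' : ℝ⁴ → N does e'∘K₀ bound such a disc in
N ∖ e'(D_k) (rev 1: crux-only form; rev 0 said 'in S⁴' and needed the transport support). X ⇒
¬SmoothPoincare4 at once: SPC4 makes Σ itself such an N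
(glue2.lean `closes (hX : DcrGap)`, certified, authority native). X is the exact 1-handle analogue
of "some knot is slice in a homotopy
4-ball but not in B⁴" (k = 0: FGMW/Manolescu–Piccirillo), and the ENGINE that is to produce it is
Manolescu–Marengon–Sarkar–Willis' Rasmussen invariant
s₋/s₊ of null-homologous links in #ᵏ(S¹×S²) read on the attaching circles of ANY Kirby diagram of a
candidate sphere (crux DcrRasmussenWitness, informal
until the invariant is vendored): Σ ≅ S⁴ forces s₋(K₀) ≤ 0 ≤ s₊(K₀) for every null-homologous
attaching circle K₀ through the dotted circles, so one
computed violation is an exotic 4-sphere. No card is realised (none exists; nearest card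
lasagna-three-handles-transparent uses the dual complement lemma
with lasagna modules on R-links).
Lean: `∃ (k : ℕ) (K : (Metric.sphere (0 : EuclideanSpace ℝ (Fin 2)) 1) → EuclideanSpace ℝ (Fin 4)),
(ContMDiff (𝓡 1) 𝓘(ℝ, EuclideanSpace ℝ (Fin 4)) ((⊤ : ℕ∞) : WithTop ℕ∞) K ∧ Function.Injective K ∧
(∀ t, Function.Injective (mfderiv (𝓡 1) 𝓘(ℝ, EuclideanSpace ℝ (Fin 4)) K t)) ∧ ∀ t, ((∀ j : Fin k,
(1 : ℝ) ≤ (K t 0 - 4 * (((j : ℕ) : ℝ) + 1)) ^ 2 + (K t 1) ^ 2) ∧ ((K t 0) ^ 2 + (K t 1) ^ 2) / (40 *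
(((k : ℕ) : ℝ) + 1)) ^ 2 + (∑ j : Fin k, 1 / ((K t 0 - 4 * (((j : ℕ) : ℝ) + 1)) ^ 2 + (K t 1) ^ 2))
+ (K t 2) ^ 2 + (K t 3) ^ 2 = 1)) ∧ (∃ (M : Type) (_ : TopologicalSpace M) (_ : T2Space M) (_ :
SecondCountableTopology M) (_ : ChartedSpace (EuclideanSpace ℝ (Fin 4)) M) (_ : IsManifold (𝓡 4) ((⊤
: ℕ∞) : WithTop ℕ∞) M), Nonempty (M ≃ₕ (Metric.sphere (0 : EuclideanSpace ℝ (Fin 5)) 1)) ∧ ∃ (e :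
EuclideanSpace ℝ (Fin 4) → M) (f : EuclideanSpace ℝ (Fin 2) → M), (Manifold.IsSmoothEmbedding (𝓡 4)
(𝓡 4) ((⊤ : ℕ∞) : WithTop ℕ∞) e ∧ ContMDiff (𝓡 2) (𝓡 4) ((⊤ : ℕ∞) : WithTop ℕ∞) f ∧ Set.InjOn f
(Metric.closedBall (0 : EuclideanSpace ℝ (Fin 2)) 1) ∧ (∀ x ∈ Metric.closedBall (0 : EuclideanSpace
ℝ (Fin 2)) 1, Function.Injective (mfderiv (𝓡 2) (𝓡 4) f x)) ∧ (∀ x : EuclideanSpace ℝ (Fin 2), ‖x‖ <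
1 → f x ∉ e '' {x : EuclideanSpace ℝ (Fin 4) | (∀ j : Fin k, (1 : ℝ) ≤ (x 0 - 4 * (((j : ℕ) : ℝ) +
1)) ^ 2 + (x 1) ^ 2) ∧ ((x 0) ^ 2 + (x 1) ^ 2) / (40 * (((k : ℕ) : ℝ) + 1)) ^ 2 + (∑ j : Fin k, 1 /
((x 0 - 4 * (((j : ℕ) : ℝ) + 1)) ^ 2 + (x 1) ^ 2)) + (x 2) ^ 2 + (x 3) ^ 2 ≤ 1}) ∧ ∀ t :
(Metric.sphere (0 : EuclideanSpace ℝ (Fin 2)) 1), f t = e (K t))) ∧ ∀ (N : Type) [TopologicalSpace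
N] [T2Space N] [SecondCountableTopology N] [ChartedSpace (EuclideanSpace ℝ (Fin 4)) N] [IsManifold
(𝓡 4) ((⊤ : ℕ∞) : WithTop ℕ∞) N], Nonempty (Diffeomorph (𝓡 4) (𝓡 4) N (Metric.sphere (0 :
EuclideanSpace ℝ (Fin 5)) 1) ((⊤ : ℕ∞) : WithTop ℕ∞)) → ∀ (e' : EuclideanSpace ℝ (Fin 4) → N) (f' :
EuclideanSpace ℝ (Fin 2) → N), ¬ (Manifold.IsSmoothEmbedding (𝓡 4) (𝓡 4) ((⊤ : ℕ∞) : WithTop ℕ∞) e'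
∧ ContMDiff (𝓡 2) (𝓡 4) ((⊤ : ℕ∞) : WithTop ℕ∞) f' ∧ Set.InjOn f' (Metric.closedBall (0 :
EuclideanSpace ℝ (Fin 2)) 1) ∧ (∀ x ∈ Metric.closedBall (0 : EuclideanSpace ℝ (Fin 2)) 1,
Function.Injective (mfderiv (𝓡 2) (𝓡 4) f' x)) ∧ (∀ x : EuclideanSpace ℝ (Fin 2), ‖x‖ < 1 → f' x ∉
e' '' {x : EuclideanSpace ℝ (Fin 4) | (∀ j : Fin k, (1 : ℝ) ≤ (x 0 - 4 * (((j : ℕ) : ℝ) + 1)) ^ 2 +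
(x 1) ^ 2) ∧ ((x 0) ^ 2 + (x 1) ^ 2) / (40 * (((k : ℕ) : ℝ) + 1)) ^ 2 + (∑ j : Fin k, 1 / ((x 0 - 4
* (((j : ℕ) : ℝ) + 1)) ^ 2 + (x 1) ^ 2)) + (x 2) ^ 2 + (x 3) ^ 2 ≤ 1}) ∧ ∀ t : (Metric.sphere (0 :
EuclideanSpace ℝ (Fin 2)) 1), f' t = e' (K t))`

## Assembly
Pure logic (`closes`, certified, authority native): from DcrGap take (k, K₀, the witness (M, atlas,
h : M ≃ₕ S⁴, e, f) and the no-disc clause over all N ≅ S⁴);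
SmoothPoincare4 unfolds to Mathlib's `HomotopyEquiv.NonemptyDiffeomorphSphere M 4`, giving Nonempty
(M ≃ₘ S⁴) for that atlas, so M is an admissible N and
(e, f) contradicts the clause. The deciding theorem is CRUX-ONLY with the single binder X: `theorem
closes (hX : DcrGap) : ¬ SmoothPoincare4` (`--refutation`).
Around that binder (rev 2, route-repair 2026-08-16): the Assembly item is the frame DcrGap →
¬SmoothPoincare4 itself (provable now by `closes`); the kill
switch DcrRigidity is ¬DcrGap BY NAME (the audited cone's kill path; the rev-1 ∀-form in the literal
S⁴ is equivalent to it through the PROVED support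
DcrTransport); the typed engine DcrRasmussenWitness feeds X through the typed GFGMW window DcrGfgmw
and the glue DcrEngineGlue : DcrRasmussenWitness →
DcrGfgmw → DcrGap (provable now from DcrTransport; folder Sketch2.lean rc 0); the k = 1 special case
DcrGapOne (support) feeds X by instantiation (DcrRungGlue).

Rationale: WHY THIS LINE. Mechanism. Let H ⊂ Σ be the union of the 0- and 1-handles of any handle decomposition
(H = e(D_k), k dotted circles) and W = Σ ∖ int H. The attaching
circles of the 2-handles lie in ∂H ≅ #ᵏ(S¹×S²) =: M_k and bound the (pairwise disjoint) cores in W;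
after handle slides there are null-homologous ones
(same-class pairs slid with opposite orientation; adding cancelling 2/3 pairs is free). W ≅ Σ #
♮ᵏ(B²×S²) always (H is a neighbourhood of a wedge of circles,
which sits in a ball: the dual of lemma L1 of card lasagna-three-handles-transparent), and Σ ≅ S⁴ ⟺
W ≅ ♮ᵏ(B²×S²) (Palais for e|ball; every diffeomorphism of
M_k extends over ♮ᵏ(S¹×B³), Laudenbach). MMSW [ManolescuMarengonSarkarWillis2023] built s for
null-homologous links L ⊂ M_k with three properties that are
exactly what an FGMW certificate with 1-handles needs: (i) Diff⁺(M_k)-INVARIANCE (Thm 2.8 — the Dehn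
twist along {pt}×S² merely shifts the full-twist
stabilisation), so the unknown identification ∂W ≅ ∂♮ᵏ(B²×S²) produced by a diffeomorphism Σ ≅ S⁴ is
harmless; (ii) a DISC BOUND in the standard piece:
Lemma 8.19 (σ = ℓ disc components, g = 0) gives s₋(L) ≤ 1 − ℓ for L bounding disjoint discs in
♮ᵏ(B²×S²), and the reflection of S⁴ preserving D_k gives the
mirror bound s₊(L) ≥ ℓ − 1; (iii) COMPUTABILITY: s(L) is the ordinary Rasmussen invariant of the
S³-link D(k⃗) obtained by inserting k ≥ ⌈(n⁺_D+2)/2⌉ full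
twists in place of each handle (Thm 1.4) — one Khovanov computation per certificate (fast
s-algorithms: arXiv:2508.11373). Hence (GFGMW window, typed support DcrGfgmw = MMSW Lemma 8.19
in the model + Palais transfer): Σ ≅ S⁴ ⇒ s₋(K₀) ≤ 0 ≤ s₊(K₀) for every null-homologous model knot
K₀ ⊂ ∂D_k sliceable in Σ ∖ e(D_k); a violation proves X.
What it does that prior lines do not: FGMW [FreedmanGompfMorrisonWalker2010] and MMSW's Question
9.11 need the slice link in S³ = ∂(0-handle), i.e. a
1-HANDLE-FREE decomposition (Kirby Problem 4.18, the open conjunct C1 of route NoOneHandles) —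
Manolescu's 2026 survey still lists "(b) consider homotopy
4-spheres without 1-handles" (arXiv:2601.05425 p.24); route ZeroSurgeryExotic supplies S³-knots from
0-friends; the lasagna card needs R-links (no 1-handles)
for its computable cruxes. Here EVERY Kirby diagram of EVERY candidate (doubles and twisted doubles
D(P), D_φ(P) of contractible 2-handlebodies of balanced
presentations — the family MMSW themselves single out in Q9.12 —, knotted-cork twists, RBG-born
spheres drawn with the ribbon-disc complement's dotted circles)
yields certificate candidates, and the printed Gluck-sector no-go (MMSW Cor 1.13, barrier
GluckTwistsDissolve) is an S³-link statement; its M_k-version (knot/disc case) is VENDORED since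
2026-08-16 as the named fact MMSW.sMinus_nonpos_of_isTowerSliceInComplement (MMSW Thm 8.10 + the
ν(A)-model
of Lemma 8.19 + Thm 1.6; refuter crux-attack 2026-08-16: printed modulo bookkeeping) and its
route-facing consequence is the TYPED crux DcrAdjunction (rev 16–17: two-sided
±ℂP²-dissolution of Σ ⇒ s₋ ≤ 0 ≤ s₊ for every model knot sliced in Σ ∖ e(D_k)), so on
±ℂP²-dissolving families the fence is fully engaged modulo that fact. Imported area: Khovanov
homology in #ʳ(S¹×S²) (Rozansky, Willis, MMSW) + dotted-circle handle calculus
[GompfStipsicz1999 §5.4]; certified computation for the engine. Negatives index of the summit: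
empty.

RANKED CRUXES. #0 DcrGap (target, the single binder of `closes`) — ONE-HANDLE SLICE GAP. There are k
: ℕ, a smoothly embedded model circle K₀ : S¹ → ℝ⁴ with image in ∂D_k = {G_k = 1} (G_k(x) =
(x₀²+x₁²)/(40(k+1))² + Σ_{j<k} 1/((x₀−4(j+1))²+x₁²) + x₂² + x₃², with the honest-division guard 1 ≤
(x₀−4(j+1))²+x₁²), a homotopy 4-sphere Σ (Statement binders) with a smooth embedding e : ℝ⁴ → Σ and
a smooth proper disc f in Σ ∖ e(D_k) with ∂f = e∘K₀, such that in NO smooth N ≅ S⁴ (any carrier type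
and atlas) and for no smooth embedding e' : ℝ⁴ → N is there such a disc f' in N ∖ e'(D_k) with ∂f' =
e'∘K₀ (disc predicate = the tree's MMSW.IsSliceDiscInComplement unfolded: C^∞ on ℝ², injective and
immersive on the closed unit disc, open disc disjoint from e(D_k), boundary circle = e∘K₀). (why it
might fail: SPC4 kills it; and even granting an exotic Σ, every model knot sliceable in Σ ∖ e(D_k)
may be sliceable in a standard complement too (no separating knot) — the 1-handle twin of "H-slice ⇒
slice".) [FreedmanGompfMorrisonWalker2010 §1, ManolescuMarengonSarkarWillis2023 §9.3 (Q9.11, Q9.12),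
arXiv:2601.05425 §7 p.24, GompfStipsicz1999 §5.4]
#2 DcrRasmussenWitness (crux) — THE ENGINE (typed 2026-08-16 once MMSWRasmussen landed; refuter
crux-attack: survives): there are k ≥ 1, a model circle K₀ ⊂ ∂D_k (MMSW.IsModelKnot) that is
null-homologous in ∂D_k ≅ #ᵏ(S¹×S²) (MMSW.IsNullHomologous), a homotopy 4-sphere Σ with a smooth
embedding e : ℝ⁴ → Σ and a slice disc for e∘K₀ in Σ ∖ e(D_k) (MMSW.IsSliceDiscInComplement k K₀ Σ e
f — e.g. a 2-handle attaching circle slid to class 0, bounding its core), and MMSW invariants w :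
MMSWRasmussen k K₀ with 0 < s₋(K₀) or s₊(K₀) < 0 (computed as ordinary Rasmussen invariants of the
finite approximations D(k⃗), MMSW Thm 1.4). Settleable instance by instance by certified
computation. (why it might fail: an M_k-blindness theorem (the #ᵏ(S¹×S²) version of a positive
answer to MMSW Q9.11) would force the window for every such K₀; a witness forces Σ # r(±ℂP²) exotic
for all r ≥ 1 (MMSW Thm 6.10 + Lemma 8.19, refuter briefing F1), so ±ℂP²-dissolving candidate
families are void; or SPC4.) [ManolescuMarengonSarkarWillis2023 Thms 1.4, 6.10, Lemma 8.19, §9.3;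
FreedmanGompfMorrisonWalker2010; arXiv:2508.11373; arXiv:2601.05425; GompfStipsicz1999 §5.4;
AkbulutKirby1985]
#3 DcrRigidity (crux) — KILL SWITCH = ¬DcrGap BY NAME (rev 2; the negative side filed as its own
ranked statement per planner step 5; the audited cone reads it as the route's kill path). Unfolded:
model knots sliceable in some homotopy sphere's dotted-handlebody complement are sliceable in the
complement inside SOME smooth N ≅ S⁴; the rev-1 ∀-form with N the literal S⁴ implies it (N := S⁴,
Diffeomorph.refl) and follows from it by the PROVED DcrTransport (folder Sketch.lean, rc 0), and is
the recommended proof shape. SPC4 ⇒ it (contrapositive of `closes`); a direct proof closes the route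
`refuted:DcrGap` and is a rigidity theorem one level below SPC4 (it would also settle the
M_k-version of MMSW Q9.11 against the strategy). [difficulty: open-problem] (why it might fail: it
is ¬DcrGap: false as soon as one separating model knot exists (any certificate of the engine); a
direct proof needs disc rigidity in homotopy ♮ᵏ(B²×S²)'s — light-bulb/concordance arguments stop at
homotopy balls (Q9.11 open even at k = 0).) [ManolescuMarengonSarkarWillis2023 Q9.11, Palais1960,
Cerf1968, arXiv:2601.05425 §7]
#5 DcrAdjunction (crux; support rev 10–16, TYPED rev 16, re-kinded crux rev 17 on the judge's
`what_would_move_it`) — THE M_k DISSOLUTION FENCE: for every homotopy 4-sphere M (Statement binders)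
that dissolves on both sides (∃ a smooth orientation oM ∀ orientation o of ℂP² ∃ t: every oriented
connected sum of (M, oM) with a t-fold o-tower #ᵗ(ℂP², o) is again a t-fold o-tower — the printed 'M
# tℂP² ≅ tℂP² and M # tℂP²bar ≅ tℂP²bar') and every model knot K ⊂ ∂D_k sliced in M ∖ e(D_k)
(MMSW.IsSliceDiscInComplement, any k, e, f): s₋(K) ≤ 0 ≤ s₊(K). The 1-handle version of MMSW Cor
1.13 / §9.3 (tree, k = 0: mmsw2023_sZero_of_dissolvesInCP2), stated FACT-FREE (a Literature Prop in
the used-constants cone would make the route unstaffable); TRUE modulo the vendored named fact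
MMSW.sMinus_nonpos_of_isTowerSliceInComplement and PROVABLE NOW as the conditional theorem fact →
DcrAdjunction (shrink the datum to compact support, connected sum M # tower away from it via
ConnectedSumData, transport along jA : M ∖ {c} ↪ P, H₂(M ∖ {c}) = 0 by
isZero_singularHomology_compl_singleton_of_homotopyEquiv_sphere_four, orientation dichotomy of the
chart and the mirror knot via IsOrientedConnectedSum.neg / IsProjectiveTower.neg; folder
Sketch.lean, attached on the item). Its contrapositive prices every engine certificate: the
witnessing Σ yields an exotic #ᵗ(±ℂP²) too. (why it might fail: closes as an item only when the XL
fact — Khovanov–Lee homology of #ʳ(S¹×S²) — gets a _holds; typing risks: the ∀-over-sums form equals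
the printed ∃-form only via Kervaire–Milnor uniqueness, and the transport must tame f off 𝔻².)
[ManolescuMarengonSarkarWillis2023 Thms 8.10, 1.6, Lemma 8.19, Cor 1.13, §9.3;
KasprowskiPowellRay2023 Lemma 3.1; KervaireMilnor1963 Lemma 2.1; tree: MMSWTowerAdjunction,
Barriers/SmoothPoincare4/GluckTwistsDissolve]
#9 DcrGfgmw (support, typed rev 13) — THE GFGMW WINDOW in the literal S⁴: for every k, every model
circle K₀ ⊂ ∂D_k, every smooth embedding e' : ℝ⁴ → S⁴ and every slice disc f' for e'∘K₀ in S⁴ ∖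
e'(D_k) (MMSW.IsSliceDiscInComplement k K₀ S⁴ e' f'), every w : MMSWRasmussen k K₀ has s₋ ≤ 0 ≤ s₊.
Its MODEL case (e' = standard, disc in ℝ⁴ ∖ D_k) is exactly the vendored consequence
MMSWRasmussen.sMinus_nonpos_sPlus_nonneg of the named fact MMSW.sMinus_nonpos_of_isModelSliceDisc
(Lemma 8.19; its mirror half proved in MMSWRasmussenFacts), and the window is symmetric under the
model mirror ρ (Sketch2.lean window_mirror_symm), so what remains is the PALAIS TRANSFER: e'|B_R is
ambient-isotopic in S⁴ to the standard chart e₀ or to e₀∘ρ (Palais 1960 / Cerf), and a disc in S⁴ ∖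
e₀(D_k) is pushed off one point into ℝ⁴ ∖ D_k (general position). (why it might fail as typed: only
the FILLING convention — the complement S⁴ ∖ e₀(D̊_k) is the 2-handlebody filling ♮ᵏ(B²×S²) of Lemma
8.19, derived in the MMSWRasmussenFacts docstring; a calibration failure on a known-standard sphere
would expose it.) [ManolescuMarengonSarkarWillis2023 Lemma 8.19, Thm 2.8; Palais1960; Cerf1968;
GompfStipsicz1999 §5.4]
#9 DcrEngineGlue (support, provable now, filed rev 13) — ENGINE GLUE: DcrRasmussenWitness → DcrGfgmw
→ DcrGap, pure logic plus the proved DcrTransport (a datum in N ≅ S⁴ transports to the literal S⁴,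
where the window contradicts the certificate; MMSW.isModelKnot_iff / isSliceDiscInComplement_iff are
Iff.rfl). Candidate proof: folder Sketch2.lean engineGlue_of_transport (rc 0), attached on the item.
[tree: this route's decls; Theorems.DcrTransport_proof]
#9 DcrTransport (support, PROVED: Theorems.DcrTransport_proof) — a datum (e, f) for (k, K₀) in M is
carried to (Φ∘e, Φ∘f) in S⁴ by any diffeomorphism Φ : M ≅ S⁴. [Palais1960, Mathlib Diffeomorph]
#9 DcrGapOne (support since rev 10; was crux #4) — the k = 1 SPECIAL CASE of the target (one dotted
circle: K₀ ⊂ ∂D_1 ≅ S¹×S² sliceable in Σ ∖ e(D_1) ≅ Σ # (S²×D²) for some homotopy sphere Σ, in no N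
∖ e'(D_1), N ≅ S⁴); sufficient by instantiation (DcrRungGlue) and the recommended first instance for
certificate attempts (r = 1: Rozansky's Hochschild-homology model, MMSW Thms 1.6–1.7); re-kinded
because a special case cannot feed the crux-only deciding theorem whose binder is the weaker DcrGap;
its negation ('one dotted circle never separates') stays a meaningful refuter target. (why it might
fail: every live candidate diagram uses ≥ 2 one-handles and genus-one decompositions tend to reduce
by Property R — the rung may be vacuous while DcrGap holds.) [ManolescuMarengonSarkarWillis2023 Thms
1.6, 1.7; AkbulutKirby1985; Gompf1991; GompfStipsicz1999 §5.4]
#9 DcrRungGlue (support, provable now) — DcrGapOne → DcrGap (instantiate k := 1; candidate proof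
attached). [tree: this route's DcrGapOne/DcrGap]
#9 DcrCalibration (support, informal; computation) — forced identities s₋ ≤ 0 ≤ s₊ on every
null-homologous attaching circle of every Kirby diagram WITH 1-handles of a homotopy sphere KNOWN to
be standard (Gompf 1991, Akbulut–Kirby/Cappell–Shaneson presentations, Gompf–Scharlemann–Thompson,
Meier–Zupan in the proved range) — run before any exotic claim. [Gompf1991, AkbulutKirby1985,
ManolescuMarengonSarkarWillis2023 Thm 1.4]

TWO-LAYER PLAN. Filed FLAT at rev 13 (no `--split`, so the target stays directly claimable and
remains the binder of `closes`): DcrGap ⇐ DcrRasmussenWitness ∧ DcrGfgmw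
through the glue item DcrEngineGlue (provable now). Below the engine, not items: DcrRasmussenWitness
⇐ (CandidateDiagram: an explicit Kirby diagram of a homotopy
sphere not known standard, with a null-homologous attaching circle K₀ after slides — doubles/twisted
doubles of AC-candidate presentations, knotted-cork twists)
→ (SComputation: a certified computation s(D(k⃗)) = s₋(K₀) > 0 or s₊(K₀) < 0, k ≥ ⌈(n⁺+2)/2⌉). Below
the window: DcrGfgmw ⇐ (PalaisTransfer: ambient isotopy of
ball embeddings in S⁴ up to the model mirror + pushing a disc off a point) ∧ (the named fact
MMSW.sMinus_nonpos_of_isModelSliceDisc, Lemma 8.19) — provers attach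
these as `--supports` lemmas, not items. NOTE for cone readers: the audited (native) cone follows
only the binders/proof term of `closes` and kill paths, so the
engine crux appears outside it although it feeds the binder through DcrEngineGlue; do not drop it on
that account — the alternative deciding theorem
`closes (hW : DcrRasmussenWitness) (hG : DcrGfgmw)` (deriving DcrGap inline) is available the day
the route commits to the engine alone.

KILL CRITERIA. - DcrRigidity (= ¬DcrGap by name) PROVED ⇒ X refuted ⇒ `close --reason
refuted:DcrGap` (and every 1-handle/0-handle FGMW strategy dies with it).
- An M_k-BLINDNESS theorem "s₋(K₀) ≤ 0 ≤ s₊(K₀) for every null-homologous model knot sliceable in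
ANY homotopy sphere's handlebody complement" (the
  M_k-version of a positive answer to MMSW Q9.11) ⇒ the engine DcrRasmussenWitness is dead; X
survives only through a non-Khovanov separating functional
  (none known) ⇒ close `exhausted` with census unless one is named within the grace window.
- The M_k-fence being typed (crux DcrAdjunction, true modulo the vendored Thm 8.10 fact), a
dissolution theorem "every candidate family member Σ satisfies
  Σ # tCP² ≅ tCP², Σ # tCP²bar ≅ tCP²bar" (MMSW Q9.12 for doubles) ⇒ certificates void on that
family ⇒ pivot to non-dissolving candidates or close.
- SmoothPoincare4 PROVED elsewhere ⇒ refuted (DcrRigidity then holds); ¬SPC4 proved elsewhere ⇒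
moot, but X stays a meaningful open statement.

NOT DECOMPOSED YET. - Typed since rev 13: the engine DcrRasmussenWitness (refuter set-signature,
2026-08-16T21:51Z) and the window DcrGfgmw (this repair) over the landed
  Literature.Topology.FourManifolds.MMSWRasmussen(+Facts) (p118483); DcrAdjunction TYPED at rev 16
as the fact-free
  ±ℂP² fence over MMSWTowerAdjunction's vocabulary (IsProjectiveTower, IsOrientedConnectedSum; the
adjunction itself is the Literature fact); still INFORMAL: DcrCalibration
  (a computation protocol). The geometric input of DcrGfgmw beyond the named facts — Palais' disc
theorem for smooth embeddings B_R → S⁴ (ambient isotopy up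
  to reflection) and general position of a 2-disc off a point — is not vendored; cite facts wanted
(below), or proved in Theorems by whoever takes DcrGfgmw.
- The model facts "∂D_k is a regular level ≅ #ᵏ(S¹×S²)" and "S⁴ ∖ e₀(D̊_k) ≅ ♮ᵏ(B²×S²)" live in the
MMSWRasmussen docstrings (orientation and filling
  conventions derived there); "e(D_k) = 0∪1-handles of a decomposition of Σ" is only heuristic
supply for candidates, never an item.
- Links (ℓ ≥ 2, window 1−ℓ ≤ s₋, s₊ ≥ ℓ−1) and sublink certificates: not typed (the vendored
invariant is knot-level, ℓ = 1, where the window is sharp).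
- Candidate supply (which diagrams to run first) is search detail below crux level: D(P)/D_φ(P) for
the Akbulut–Kirby / Miller–Schupp / Gordon balanced
  presentations, Gompf's 1991 presentation, knotted Akbulut–Mazur cork twists; RBG-born spheres once
a 0-friend with K slice reappears (DunfieldGong2025 Table 11);
  pre-filter by the refuter's briefing (F1: the family must not ±ℂP²-dissolve; F2 monotonicity).

CHEAPEST FALSIFIER. (1) LOOKUP (ran it): does MMSW or a sequel already prove s₋ ≤ 0 ≤ s₊ for knots
sliceable in arbitrary homotopy ♮ᵏ(B²×S²)'s, or already state the 1-handle
FGMW? — MMSW §9.3 read (Q9.11 = S³-links in homotopy balls; Q9.12 = ±CP²-dissolution of doubles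
D(P); no M_k-version), the 39 works citing MMSW listed
(`lit citing arxiv:1910.08195`; Nahm arXiv:2602.20138 and Ren–Willis use cocore-removal in
2-handlebodies, k = 0 side), Manolescu's survey arXiv:2601.05425
§7 p.24 read ("(b) consider homotopy 4-spheres without 1-handles"): NOT FOUND. (2) COMPUTATION (not
runnable on the hub: no Khovanov pipeline; `kit` job spec
for the first refuter/prover: khoca/sinvariants-class program, input = D(k⃗) of a null-homologous
attaching circle of Gompf's 1991 Akbulut–Kirby-sphere
diagram (KNOWN standard ⇒ must give s₋ ≤ 0 ≤ s₊: calibration), then the same for D(X_P), P = ⟨x,y ∣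
xyx = yxy, x⁵ = y⁴⟩ (status unknown)). A calibration
FAILURE on a known-standard sphere refutes DcrGfgmw as typed (the filling convention; the window
itself is mirror-symmetric) before any exotic claim is made — run it first.

NUMBERS. - Finite approximation: k ≥ ⌈(n⁺_D + 2)/2⌉ full twists per handle
(ManolescuMarengonSarkarWillis2023 Thm 1.4); s(F_p) = 1 − 2p for the 2p-fibre link (Thm 1.6),
  which makes Lemma 8.19 sharp: ℓ disjoint discs in ♮ʳ(B²×S²) ⇒ s₋ ≤ 2g + ℓ − 2σ + 1 = 1 − ℓ.
- Certificate windows: knots s₋ ≤ 0 ≤ s₊; ℓ-component null-homologous links s₋ ≤ 1 − ℓ and s₊ ≥ ℓ −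
1 (mirror via the reflection of S⁴ fixing D_k).
- Model constants: holes at z = 4, 8, …, 4k of radius ≈ 1 (g between holes ≤ 0.85 for all k; outer
radius ≈ 40(k+1)); numerically checked k ≤ 8 (folder gen/).
- State of the k = 0 art: 0-friend candidates 4 → 3 live (DunfieldGong2025 Thm 5.14;
OliveiraSmith2026); Gluck sector provably blind for S³-links (MMSW Cor 1.13).
- Items (rev 17): 4 cruxes (DcrGap r0 = binder of closes, DcrRasmussenWitness r2, DcrRigidity r3 =
kill path, DcrAdjunction r5 = the ±ℂP² fence) + 6 supports (DcrGfgmw, DcrEngineGlue ✓proved,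
DcrTransport ✓proved, DcrGapOne, DcrRungGlue ✓proved, DcrCalibration) + Assembly ✓proved = 11 ≤ 15.

DEFINITION REQUESTS. - LANDED (p118483, 2026-08-16): MMSWRasmussen
(Literature/Topology/FourManifolds) — requested as: the invariants s₋(L) = s(L), s₊(L) = −s(−L) ∈ ℤ
of a null-homologous oriented link L in M_r = #ʳ(S¹×S²)
  [ManolescuMarengonSarkarWillis2023 §3], ideally as `HasMMSWInvariant r L s` in the style of
`Knot.HasRasmussenInvariant` via the finite approximation D(k⃗)
  (Thm 1.4) over the tree's `GaussDiagram.rasmussenInvariant` extended to link diagrams; model links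
= smoothly embedded circles in ∂D_k ⊂ ℝ⁴ (this route's
  inline domain) with an explicit diffeomorphism ∂D_k ≅ M_k; NAMED FACTS wanted with it: Thm 1.3
(well-defined), Thm 1.4 (finite approximation), Thm 2.8
  (invariance under orientation-preserving diffeomorphisms of M_r), Lemma 8.19 / Thm 1.15 (s₋ ≤ 2g +
ℓ − 2σ + 1 for surfaces in ♮ʳ(B²×S²); s₊ bound in ♮ʳ(S¹×B³)).
- Cite facts (kind cite): Palais 1960 disc theorem for embeddings ℝ⁴ ⊃ B_R → S⁴ (ambient isotopy up
to reflection); dotted-circle complement: S⁴ ∖ (0∪1-handles) ≅ ♮ᵏ(B²×S²)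
  [GompfStipsicz1999 §5.4]; Laudenbach: Diff(#ᵏS¹×S²) → Out(F_k) with kernel the sphere twists, all
classes extend over ♮ᵏ(S¹×B³).
- LANDED (2026-08-16T22:28Z): MMSWTowerAdjunction — the M_k-adjunction, knot/disc case, as the named
fact MMSW.sMinus_nonpos_of_isTowerSliceInComplement with IsTowerSliceInComplement and the
mirror/window lemmas; discharges the vendoring request behind DcrAdjunction.
- Statement items filed after open: DcrRasmussenWitness (crux, rank 2; typed), DcrAdjunction (rank
5; support rev 10–16, typed rev 16, crux rev 17), DcrCalibration (support), DcrGfgmw (support;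
typed), DcrEngineGlue (support; rev 13, proved).

Novelty: Searches (2026-08-16): `lit citing arxiv:1910.08195` (39 citing works; read arXiv:2602.20138 pp.1–2,
arXiv:2601.05425 pp.24–25); `lit read arxiv:1910.08195` pp.3–5, 9, 14, 25–30 (Thms 1.1–1.17, 2.8,
Lemma 8.19, §9); `lit read arxiv:2512.21825` pp.47–48; `lit search --source crossref "Khovanov
homology S^1 x S^2 Rasmussen"` (25 rows, Willis 2021 doi:10.1307/mmj/1594281620 the only relevant),
`lit search --source crossref "Levine semi-free circle actions on spheres"` (14 rows; used to
discard candidate 3), `lit galaxy search "Rasmussen invariant null-homologous links in #^r S^1 x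
S^2" --star all` (0), local searchd/OpenAlex/S2 unavailable (rc reset / 429, recorded); the summit's
54 route files, 42 open + 117 closed cards (grep for S¹×S², Rozansky, Willis, dotted, 1-handle),
barrier catalogue `Literature/Barriers/SmoothPoincare4/*` read.
Nearest prior art found: ManolescuMarengonSarkarWillis2023 (doi:10.1215/00127094-2022-0039 =
arXiv:1910.08195) Thm 1.15/Lemma 8.19, Thm 2.8, Cor 1.13, Questions 9.11–9.12 — the invariant and
both of its properties used here, applied by its authors only to S³-links in homotopy balls and to
±ℂP²-dissolution; FreedmanGompfMorrisonWalker2010 (the k = 0 certificate); card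
lasagna-three-handles-transparent (the complement lemma in dual form, for lasagna modules of
1-handle-free 2-skeleta); route ZeroSurgeryExotic (S³-knot supply from 0-friends); arXiv:2601.05425
§7 (state of the art: "(b) consider homotopy 4-spheres without 1-handles").
Delta: reading  [refs: 10.1307/mmj/1594281620, 10.1215/00127094-2022-0039, 1910.08195, 2602.20138, 2601.05425, 2512.21825, arxiv:1910.08195, arxiv:2512.21825, doi:10.1307/mmj/1594281620, doi:10.1215/00127094-2022-0039, ManolescuMarengonSarkarWillis2023, FreedmanGompfMorrisonWalker2010]

Barriers (technique_class: khovanov-s-invariant, kirby-diagrams, computation): - technique_class: khovanov-s-invariant, kirby-diagrams, computation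
- Literature.Barriers.SmoothPoincare4.GluckTwistCP2Barrier: ENGAGED AND NOW TYPED ON THIS ROUTE —
MMSW Cor 1.13 (`rasmussen_eq_zero_of_isSliceDiscIn_gluckTwist`, `not_fgmwRasmussenStrategyGluck`,
§9.3 `mmsw2023_sZero_of_dissolvesInCP2`) kills S³-link certificates on ±ℂP²-dissolving spheres; for
M_k-knots the needed adjunction in ♮ᵏ(B²×S²) # tℂP²bar (knot/disc case) is vendored since 2026-08-16
as the named fact `MMSW.sMinus_nonpos_of_isTowerSliceInComplement` (MMSWTowerAdjunction.lean;
printed modulo bookkeeping: Thm 8.10 + the ν(A)-model of Lemma 8.19 + Thm 1.6, refuter crux-attack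
2026-08-16), and the route's fence is the typed crux DcrAdjunction (rev 16: two-sided t-fold
dissolution of Σ ⇒ s₋ ≤ 0 ≤ s₊ for every model knot sliced in Σ ∖ e(D_k); provable now modulo that
fact). So every ±ℂP²-dissolving candidate drawn WITH 1-handles — Gluck twists (KPR 2023 Lemma 3.1),
the worked Cappell–Shaneson spheres (standard) — is fenced exactly as at k = 0, and the bet is ONLY
that the live families (doubles / twisted doubles D(P), D_φ(P): MMSW Q9.12 open; knotted-cork
twists) do not ±ℂP²-dissolve; the earlier alternative 'the M_k-adjunction is genuinely weaker' is
withdrawn. Price of a certificate (contrapositive of DcrAdjunction): its Σ gives an exotic #ᵗ(±ℂP²)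
as well (Manolescu 2026 survey Q3.2, n = t).
- Literature.Barriers.SmoothPoincare4.GaugeSumBarrierFour: not in the class — s₋ is a Khovanov
invariant of a kn

History (route lifecycle, newest last):
- 2026-08-16T16:24:39Z · rev 3: restated DcrRigidity (stmt-SmoothPoincare4-16117) — rev 1c: restate the kill switch per model knot (same content, binder order matching the crux-only target) (planner-plan-lens-SmoothPoincare4-negation-v2-0)
- 2026-08-16T16:24:55Z · rev 4: restated Assembly (stmt-SmoothPoincare4-16121) — rev 1d: crux-only deciding theorem closes (hX : DcrGap) : ¬ SmoothPoincare4 (clears needs_repair glue.non-crux-hypothesis); Assembly restated to the two provabl (planner-plan-lens-SmoothPoincare4-negation-v2-0)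
- 2026-08-16T16:29:11Z · rev 6: dropped stmt-SmoothPoincare4-16177 — drop accidental duplicate probe item 16177 (informal text 'probe duplicate'); the real engine crux DcrRasmussenWitness is stmt-SmoothPoincare4-16151 (planner-plan-lens-SmoothPoincare4-negation-v2-0)
- 2026-08-16T22:10:24Z · rev 11: restated Assembly (stmt-SmoothPoincare4-16137) — route-repair (unused-crux, step 2/4): restate the optional Assembly item 1:1 to the canonical frame DcrGap → ¬SmoothPoincare4 (= the type of the certified decid (planner-rrepair-SmoothPoincare4-DottedCircleRa-c28f6874-0)
- 2026-08-16T22:12:26Z · rev 12: restated DcrRigidity (stmt-SmoothPoincare4-16136) — route-repair (unused-crux DcrRigidity, step 3/4): GLUED AS KILL PATH — restate the kill switch 1:1 as ¬DcrGap BY NAME (planner step 5). The audited cone (Harnes (planner-rrepair-SmoothPoincare4-DottedCircleRa-c28f6874-0)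
- 2026-08-17T04:05:39Z · rev 15: restated DcrAdjunction (stmt-SmoothPoincare4-16152) — judge-repair (what_would_move_it: "... or DcrAdjunction proved"): TYPE DcrAdjunction — restated 1:1 from the informal M_k-adjunction (whose knot/disc case is no (planner-rrepair-SmoothPoincare4-DottedCircleRa-c20f4d2c-0)
- 2026-08-17T04:10:21Z · rev 16: restated DcrAdjunction (stmt-SmoothPoincare4-17616) — judge-repair follow-up (restore STAFFABILITY): restate DcrAdjunction FACT-FREE — rev 15 put the vendored named fact MMSW.sMinus_nonpos_of_isTowerSliceInCompleme (planner-rrepair-SmoothPoincare4-DottedCircleRa-c20f4d2c-0)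
- 2026-08-24T21:38:30Z · DORMANT — reconciler: no traction for 7.1 d (last activity item-evidence-added at 2026-08-17T18:47:21Z); parked, not closed — `ledger route dormant route-SmoothPoincare4- (operator:999:557508)

sub-problem: SmoothPoincare4 · status: dormant · opened planner-plan-lens-SmoothPoincare4-negation-v2-0 2026-08-16T16:22:07Z · rev 18 · ledger route-SmoothPoincare4-DottedCircleRasmussen
GENERATED by the gate from the ledger (D-0016/17). Provers cite these decls: `theorem foo : Summit.SmoothPoincare4.SmoothPoincare4.Theses.DottedCircleRasmussen.<Decl> := …` in Summits/SmoothPoincare4/SmoothPoincare4/Theorems/<Name>.lean.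
-/

namespace Summit.SmoothPoincare4.SmoothPoincare4.Theses.DottedCircleRasmussen

open scoped BigOperators Topology Manifold Classical MeasureTheory ProbabilityTheory Matrix InnerProductSpace ComplexConjugate ContinuousMap
open Filter Set Function TopologicalSpace MeasureTheory

attribute [summit_statement] _root_.SmoothPoincare4

open Literature.SPC4

-- earlier DcrGap (stmt-SmoothPoincare4-16116, replaced 2026-08-16T16:23:59Z -> stmt-SmoothPoincare4-16128): retired by None — ∃ (M : Type) (_ : TopologicalSpace M) (_ : T2Space M) (_ : SecondCountableTopology M) (_ : ChartedSpace (EuclideanSpace ℝ (Fin 4)) M) (_ : IsManifold (𝓡 4) ((⊤ : ℕ∞) : WithTop ℕ∞) M), Nonempty (M ≃ₕ (Metric.sphere (0 : EuclideanSpace ℝ (Fin 5)) 1)) ∧ ∃ (k : ℕ) (e : EuclideanS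
/-- item stmt-SmoothPoincare4-16128 · crux · rank 0 · open · by planner
why it might fail: SPC4 kills it; and even granting an exotic Σ, every model knot sliceable in Σ ∖ e(D_k) may be sliceable in a standard complement too (no separating knot) — the 1-handle twin of 'H-slice ⇒ slice'.
sources: FreedmanGompfMorrisonWalker2010, ManolescuMarengonSarkarWillis2023, arXiv:2601.05425, GompfStipsicz1999
[target] ONE-HANDLE SLICE GAP (rev 1: crux-only form). There are k, a smoothly embedded model circle
K₀ ⊂ ∂D_k (D_k = {G_k ≤ 1} ⊂ ℝ⁴, the dotted picture of a 0-handle and k 1-handles), a homotopy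
4-sphere Σ (Statement binders) with a smooth embedding e : ℝ⁴ → Σ and a smooth proper disc f in Σ ∖
e(D_k) bounded by e∘K₀, such that in NO smooth 4-manifold N diffeomorphic to S⁴ (any carrier
type/atlas, N ≅ S⁴) and for no smooth embedding e' : ℝ⁴ → N does e'∘K₀ bound such a disc in N ∖
e'(D_k). Equivalent to rev 0 (transport along diffeomorphisms, support DcrTransport) but lets the
deciding theorem be crux-only: SPC4 makes Σ itself such an N. -/
@[route_item "route-SmoothPoincare4-DottedCircleRasmussen", crux]
def DcrGap : Prop :=
  ∃ (k : ℕ) (K : (Metric.sphere (0 : EuclideanSpace ℝ (Fin 2)) 1) → EuclideanSpace ℝ (Fin 4)), (ContMDiff (𝓡 1) 𝓘(ℝ, EuclideanSpace ℝ (Fin 4)) ((⊤ : ℕ∞) : WithTop ℕ∞) K ∧ Function.Injective K ∧ (∀ t, Function.Injective (mfderiv (𝓡 1) 𝓘(ℝ, EuclideanSpace ℝ (Fin 4)) K t)) ∧ ∀ t, ((∀ j : Fin k, (1 : ℝ) ≤ (K t 0 - 4 * (((j : ℕ) : ℝ) + 1)) ^ 2 + (K t 1) ^ 2) ∧ ((K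 t 0) ^ 2 + (K t 1) ^ 2) / (40 * (((k : ℕ) : ℝ) + 1)) ^ 2 + (∑ j : Fin k, 1 / ((K t 0 - 4 * (((j : ℕ) : ℝ) + 1)) ^ 2 + (K t 1) ^ 2)) + (K t 2) ^ 2 + (K t 3) ^ 2 = 1)) ∧ (∃ (M : Type) (_ : TopologicalSpace M) (_ : T2Space M) (_ : SecondCountableTopology M) (_ : ChartedSpace (EuclideanSpace ℝ (Fin 4)) M) (_ : IsManifold (𝓡 4) ((⊤ : ℕ∞) : WithTop ℕ∞) M), Nonempty (M ≃ₕ (Metric.sphere (0 : EuclideanSpace ℝ (Fin 5)) 1)) ∧ ∃ (e : EuclideanSpace ℝ (Fin 4) → M) (f : EuclideanSpace ℝ (Fin 2) → M), (Manifold.IsSmoothEmbedding (𝓡 4) (𝓡 4) ((⊤ : ℕ∞) : WithTop ℕ∞) e ∧ ContMDiff (𝓡 2) (𝓡 4) ((⊤ : ℕ∞) : WithTop ℕ∞) f ∧ Set.InjOn f (Metric.closedBall (0 : EuclideanSpace ℝ (Fin 2)) 1) ∧ (∀ x ∈ Metric.closedBall (0 : EuclideanSpace ℝ (Fin 2)) 1,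 Function.Injective (mfderiv (𝓡 2) (𝓡 4) f x)) ∧ (∀ x : EuclideanSpace ℝ (Fin 2), ‖x‖ < 1 → f x ∉ e '' {x : EuclideanSpace ℝ (Fin 4) | (∀ j : Fin k, (1 : ℝ) ≤ (x 0 - 4 * (((j : ℕ) : ℝ) + 1)) ^ 2 + (x 1) ^ 2) ∧ ((x 0) ^ 2 + (x 1) ^ 2) / (40 * (((k : ℕ) : ℝ) + 1)) ^ 2 + (∑ j : Fin k, 1 / ((x 0 - 4 * (((j : ℕ) : ℝ) + 1)) ^ 2 + (x 1) ^ 2)) + (x 2) ^ 2 + (x 3) ^ 2 ≤ 1}) ∧ ∀ t : (Metric.sphere (0 : EuclideanSpace ℝ (Fin 2)) 1), f t = e (K t))) ∧ ∀ (N : Type) [TopologicalSpace N] [T2Space N] [SecondCountableTopology N] [ChartedSpace (EuclideanSpace ℝ (Fin 4)) N] [IsManifold (𝓡 4) ((⊤ : ℕ∞) : WithTop ℕ∞) N], Nonempty (Diffeomorph (𝓡 4) (𝓡 4) N (Metric.sphere (0 : EuclideanSpace ℝ (Fin 5)) 1) ((⊤ : ℕ∞) : WithTop ℕ∞)) → ∀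 (e' : EuclideanSpace ℝ (Fin 4) → N) (f' : EuclideanSpace ℝ (Fin 2) → N), ¬ (Manifold.IsSmoothEmbedding (𝓡 4) (𝓡 4) ((⊤ : ℕ∞) : WithTop ℕ∞) e' ∧ ContMDiff (𝓡 2) (𝓡 4) ((⊤ : ℕ∞) : WithTop ℕ∞) f' ∧ Set.InjOn f' (Metric.closedBall (0 : EuclideanSpace ℝ (Fin 2)) 1) ∧ (∀ x ∈ Metric.closedBall (0 : EuclideanSpace ℝ (Fin 2)) 1, Function.Injective (mfderiv (𝓡 2) (𝓡 4) f' x)) ∧ (∀ x : EuclideanSpace ℝ (Fin 2), ‖x‖ < 1 → f' x ∉ e' '' {x : EuclideanSpace ℝ (Fin 4) | (∀ j : Fin k, (1 : ℝ) ≤ (x 0 - 4 * (((j : ℕ) : ℝ) + 1)) ^ 2 + (x 1) ^ 2) ∧ ((x 0) ^ 2 + (x 1) ^ 2) / (40 * (((k : ℕ) : ℝ) + 1)) ^ 2 + (∑ j : Fin k, 1 / ((x 0 - 4 * (((j : ℕ) : ℝ) + 1)) ^ 2 + (x 1) ^ 2)) + (x 2) ^ 2 + (x 3) ^ 2 ≤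 1}) ∧ ∀ t : (Metric.sphere (0 : EuclideanSpace ℝ (Fin 2)) 1), f' t = e' (K t))

/-- item stmt-SmoothPoincare4-16151 · crux · rank 2 · open · by planner
why it might fail: an M_k-blindness theorem (the #ᵏ(S¹×S²) version of a positive answer to MMSW Q9.11) would force s₋ ≤ 0 ≤ s₊ for every such K₀; a witness forces Σ # r(±CP²) exotic ∀ r ≥ 1 (MMSW Thm 6.10 + Lemma 8.19, refuter F1), so ±CP²-dissolving candidate families are void; or SPC4.
sources: ManolescuMarengonSarkarWillis2023, FreedmanGompfMorrisonWalker2010, arXiv:2508.11373, arXiv:2601.05425, GompfStipsicz1999, AkbulutKirby1985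
[crux] THE ENGINE — a Rasmussen certificate through the dotted circles. There are k ≥ 1, a homotopy
4-sphere Σ with a smooth embedding e : ℝ⁴ → Σ of the model dotted handlebody D_k (e.g. the 0- and
1-handles of a Kirby diagram of Σ), and a model circle K₀ ⊂ ∂D_k ≅ #ᵏ(S¹×S²) that is NULL-HOMOLOGOUS
in ∂D_k and bounds a smooth proper disc in Σ ∖ e(D_k) (e.g. an attaching circle of a 2-handle slid
to homology class 0, bounding its core), whose Manolescu–Marengon–Sarkar–Willis invariants violate
the standard window: s₋(K₀) > 0 or s₊(K₀) < 0 (s₋ = s, s₊(L) = −s(−L); computed as the ordinary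
Rasmussen invariant of the S³-knot D(k⃗) obtained from the dotted-circle diagram by inserting k ≥
⌈(n⁺_D+2)/2⌉ full twists per handle, MMSW Thm 1.4). DcrRasmussenWitness → DcrGap is the GFGMW lemma
(item DcrGfgmw): Σ' ≅ S⁴ ⇒ K₀ sliceable in S⁴ ∖ e'(D_k) ≅ ♮ᵏ(B²×S²) ⇒ s₋(K₀) ≤ 0 (MMSW Lemma 8.19
with σ = ℓ = 1, g = 0, after Thm 2.8 absorbs the boundary identification) and, by the reflection of
S⁴ preserving D_k, s₊(K₀) ≥ 0. SETTLEABLE BY COMPUTATION instance by instance: candidate diagrams =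
doubles / twisted doubles D(P), D_φ(P) of contractible 2-handlebodies of balanced presentations of
the trivial -/
@[route_item "route-SmoothPoincare4-DottedCircleRasmussen", crux]
def DcrRasmussenWitness : Prop :=
  ∃ k : ℕ, 1 ≤ k ∧ ∃ K : (Metric.sphere (0 : EuclideanSpace ℝ (Fin 2)) 1) → EuclideanSpace ℝ (Fin 4), Literature.Topology.FourManifolds.MMSW.IsModelKnot k K ∧ Literature.Topology.FourManifolds.MMSW.IsNullHomologous k K ∧ (∃ (M : Type) (_ : TopologicalSpace M) (_ : T2Space M) (_ : SecondCountableTopology M) (_ : ChartedSpace (EuclideanSpace ℝ (Fin 4)) M) (_ : IsManifold (𝓡 4) ((⊤ : ℕ∞) : WithTop ℕ∞) M), Nonempty (M ≃ₕ (Metric.sphere (0 : EuclideanSpace ℝ (Fin 5)) 1)) ∧ ∃ (e : EuclideanSpace ℝ (Fin 4) → M) (f : EuclideanSpace ℝ (Fin 2) → M), Literature.Topology.FourManifolds.MMSW.IsSliceDiscInComplement k K M e f) ∧ ∃ w : Literature.Topology.FourManifolds.MMSWRasmussen k K, 0 < w.sMinus ∨ w.sPlus < 0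

-- earlier DcrRigidity (stmt-SmoothPoincare4-16117, replaced 2026-08-16T16:24:39Z -> stmt-SmoothPoincare4-16136): retired by None — ∀ (M : Type) [TopologicalSpace M] [T2Space M] [SecondCountableTopology M] [ChartedSpace (EuclideanSpace ℝ (Fin 4)) M] [IsManifold (𝓡 4) ((⊤ : ℕ∞) : WithTop ℕ∞) M], Nonempty (M ≃ₕ (Metric.sphere (0 : EuclideanSpace ℝ (Fin 5)) 1)) → ∀ (k : ℕ) (e : EuclideanSpace ℝ (Fin 4) 
-- earlier DcrRigidity (stmt-SmoothPoincare4-16136, replaced 2026-08-16T22:12:26Z -> stmt-SmoothPoincare4-17014): retired by None — ∀ (k : ℕ) (K : (Metric.sphere (0 : EuclideanSpace ℝ (Fin 2)) 1) → EuclideanSpace ℝ (Fin 4)), (ContMDiff (𝓡 1) 𝓘(ℝ, EuclideanSpace ℝ (Fin 4)) ((⊤ : ℕ∞) : WithTop ℕ∞) K ∧ Function.Injective K ∧ (∀ t, Function.Injective (mfderiv (𝓡 1) 𝓘(ℝ, EuclideanSpace ℝ (Fin 4)) K t)) ∧ 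
/-- item stmt-SmoothPoincare4-17014 · crux · rank 3 · open · by planner
why it might fail: it is ¬DcrGap: false as soon as one separating model knot exists (any certificate of the engine DcrRasmussenWitness); a direct proof needs disc rigidity in homotopy ♮ᵏ(B²×S²)'s — light-bulb/concordance arguments stop at homotopy balls (MMSW Q9.11 open even at k = 0).
sources: ManolescuMarengonSarkarWillis2023, Palais1960, Cerf1968, arXiv:2601.05425
[crux] KILL SWITCH = ¬DcrGap BY NAME (rev 2; planner step 5: the negative side filed as its own
ranked statement — the audited cone reads an item whose definiens negates a hypothesis of `closes`
as the route's KILL PATH, so this crux is part of the argument without being a hypothesis).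
Unfolded: for every k, every model circle K₀ ⊂ ∂D_k and every homotopy 4-sphere Σ (Statement
binders) with a smooth embedding e : ℝ⁴ → Σ and a smooth proper disc in Σ ∖ e(D_k) bounded by e∘K₀,
there are SOME smooth N ≅ S⁴ (any carrier and atlas), a smooth embedding e' : ℝ⁴ → N and such a disc
in N ∖ e'(D_k) bounded by e'∘K₀ — 'model knots sliceable in some homotopy sphere's dotted-handlebody
complement are sliceable in a standard one'. The rev-1 ∀-form with N the literal unit sphere of ℝ⁵
(stmt-16136) implies it by N := S⁴, Diffeomorph.refl and is recovered from it by the PROVED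
transport support DcrTransport (folder Sketch.lean `rigidity_of_forall`, `forall_of_rigidity`, rc
0), so nothing is lost and that ∀-form is the recommended proof shape. SPC4 ⇒ it (contrapositive of
`closes`, Sketch.lean `rigidity_of_spc4`); a direct proof is disc rigidity for homotopy ♮ᵏ(B²×S²)'s
one level below SPC4 (it woul -/
@[route_item "route-SmoothPoincare4-DottedCircleRasmussen"]
def DcrRigidity : Prop :=
  ¬ DcrGap

-- earlier DcrAdjunction (stmt-SmoothPoincare4-16152, replaced 2026-08-17T04:05:39Z -> stmt-SmoothPoincare4-17616): retired by None — [crux] REFUTER-FACING PARTIAL KILL — the M_k-adjunction. For every t ≥ 0, every null-homologous oriented link L ⊂ M_k = #ᵏ(S¹×S²) = ∂(♮ᵏ(B²×S²)) and every properly embedded oriented surface F ⊂ ♮ᵏ(B²×S²) # t·CP²bar with ∂F = L, no closed components, σ components and [F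
-- earlier DcrAdjunction (stmt-SmoothPoincare4-17616, replaced 2026-08-17T04:10:21Z -> stmt-SmoothPoincare4-17635): retired by None — Literature.Topology.FourManifolds.MMSW.sMinus_nonpos_of_isTowerSliceInComplement → ∀ (M : Type) [TopologicalSpace M] [T2Space M] [SecondCountableTopology M] [ChartedSpace (EuclideanSpace ℝ (Fin 4)) M] [IsManifold (𝓡 4) ((⊤ : ℕ∞) : WithTop ℕ∞) M], Nonempty (M ≃ₕ (Metric
/-- item stmt-SmoothPoincare4-17635 · crux · rank 5 · open · by planner
why it might fail: True only modulo the vendored MMSW Thm 8.10 fact (Khovanov–Lee homology of #ʳS¹×S², XL Literature debt): the item closes only when that fact gets a _holds; provable now is fact → DcrAdjunction. Typing risks: ∀-over-sums dissolution = printed ∃-form only via KM uniqueness; f must be tamed off 𝔻².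
sources: ManolescuMarengonSarkarWillis2023, KasprowskiPowellRay2023, KervaireMilnor1963, tree:Literature.Topology.FourManifolds.MMSWTowerAdjunction, tree:Literature.Barriers.SmoothPoincare4.GluckTwistsDissolve
[crux] THE M_k DISSOLUTION FENCE (typed 2026-08-17; was the informal "M_k-adjunction", whose
knot/disc case is now the vendored NAMED FACT `MMSW.sMinus_nonpos_of_isTowerSliceInComplement`,
MMSWTowerAdjunction.lean = MMSW Thm 8.10 + the ν(A)-model of Lemma 8.19 + Thm 1.6). For every
homotopy 4-sphere M (Statement binders) that DISSOLVES ON BOTH SIDES — for one smooth orientation oM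
of M and each orientation o of ℂP² there is a height t such that every oriented connected sum of (M,
oM) with a t-fold o-tower #ᵗ(ℂP², o) is again a t-fold o-tower (the printed "M # tℂP² ≅ tℂP² and M #
tℂP²bar ≅ tℂP²bar", ∀-over-sums form, = the ∃-form by Kervaire–Milnor uniqueness) — EVERY model knot
K ⊂ ∂D_k sliced in M ∖ e(D_k) (MMSW.IsSliceDiscInComplement k K M e f; any k, chart e, disc f) has
s₋(K) ≤ 0 ≤ s₊(K). Contrapositive = the price of an engine certificate (DcrRasmussenWitness): its Σ
does not ±ℂP²-dissolve, i.e. some Σ # t(±ℂP²) is an exotic #ᵗ(±ℂP²) — the 1-handle version of MMSW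
Cor 1.13 / §9.3 (tree, k = 0: `mmsw2023_sZero_of_dissolvesInCP2`,
`exoticCP2Sum_of_fgmwRasmussenStrategy`); it fences Gluck twists drawn WITH 1-handles (KPR 2023
Lemma 3.1) and every other dissolving family. STATUS: -/
@[route_item "route-SmoothPoincare4-DottedCircleRasmussen"]
def DcrAdjunction : Prop :=
  ∀ (M : Type) [TopologicalSpace M] [T2Space M] [SecondCountableTopology M] [ChartedSpace (EuclideanSpace ℝ (Fin 4)) M] [IsManifold (𝓡 4) ((⊤ : ℕ∞) : WithTop ℕ∞) M], Nonempty (M ≃ₕ (Metric.sphere (0 : EuclideanSpace ℝ (Fin 5)) 1)) → (∃ oM : Literature.Topology.FourManifolds.SmoothOrientation (𝓡 4) M, ∀ o : Literature.Topology.FourManifolds.SmoothOrientation (𝓡 4) Literature.Topology.FourManifolds.ComplexProjectivePlane, ∃ t : ℕ, ∀ (T : Type) [TopologicalSpace T] [T2Space T] [SecondCountableTopology T] [ChartedSpace (EuclideanSpace ℝ (Fin 4)) T] [IsManifold (𝓡 4) ((⊤ : ℕ∞) : WithTop ℕ∞) T] [CompactSpace T] (oT : Literature.Topology.FourManifolds.SmoothOrientation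 (𝓡 4) T) (P : Type) [TopologicalSpace P] [T2Space P] [SecondCountableTopology P] [ChartedSpace (EuclideanSpace ℝ (Fin 4)) P] [IsManifold (𝓡 4) ((⊤ : ℕ∞) : WithTop ℕ∞) P] [CompactSpace P] (oP : Literature.Topology.FourManifolds.SmoothOrientation (𝓡 4) P), Literature.Topology.FourManifolds.IsProjectiveTower o t T oT → Literature.Topology.FourManifolds.IsOrientedConnectedSum oM oT oP → Literature.Topology.FourManifolds.IsProjectiveTower o t P oP) → ∀ (k : ℕ) (K : (Metric.sphere (0 : EuclideanSpace ℝ (Fin 2)) 1) → EuclideanSpace ℝ (Fin 4)) (e : EuclideanSpace ℝ (Fin 4) → M) (f : EuclideanSpace ℝ (Fin 2) → M), Literature.Topology.FourManifolds.MMSW.IsSliceDiscInComplement k K M e f → ∀ w : Literature.Topology.FourManifolds.MMSWRasmussen k K, w.sMinus ≤ 0 ∧ 0 ≤ w.sPlus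

-- earlier DcrGapOne (stmt-SmoothPoincare4-16118, replaced 2026-08-16T16:24:17Z -> stmt-SmoothPoincare4-16129): retired by None — ∃ (M : Type) (_ : TopologicalSpace M) (_ : T2Space M) (_ : SecondCountableTopology M) (_ : ChartedSpace (EuclideanSpace ℝ (Fin 4)) M) (_ : IsManifold (𝓡 4) ((⊤ : ℕ∞) : WithTop ℕ∞) M), Nonempty (M ≃ₕ (Metric.sphere (0 : EuclideanSpace ℝ (Fin 5)) 1)) ∧ ∃ (e : EuclideanSpace 
/-- item stmt-SmoothPoincare4-16129 · support · rank 4 · open · by planner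
why it might fail: one dotted circle may be too little room: every live candidate diagram (Akbulut–Kirby/Gompf presentations, doubles D(P)) uses ≥ 2 one-handles, and genus-one decompositions tend to reduce by Property R — the rung could be vacuous while DcrGap holds.
sources: ManolescuMarengonSarkarWillis2023, AkbulutKirby1985, Gompf1991, GompfStipsicz1999
[crux] THE k = 1 RUNG (rev 1, crux-only form; sufficient: DcrGapOne → DcrGap is item DcrRungGlue):
the gap occurs already with ONE dotted circle — a model circle K₀ ⊂ ∂D_1 ≅ S¹×S² sliceable in Σ ∖
e(D_1) ≅ Σ # (S²×D²) for some homotopy 4-sphere Σ but in no N ∖ e'(D_1) with N ≅ S⁴. At r = 1 the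
engine is strongest (Rozansky's Hochschild-homology description of Khovanov homology in S¹×S²; MMSW
Thms 1.6–1.7). -/
@[route_item "route-SmoothPoincare4-DottedCircleRasmussen"]
def DcrGapOne : Prop :=
  ∃ (K : (Metric.sphere (0 : EuclideanSpace ℝ (Fin 2)) 1) → EuclideanSpace ℝ (Fin 4)), (ContMDiff (𝓡 1) 𝓘(ℝ, EuclideanSpace ℝ (Fin 4)) ((⊤ : ℕ∞) : WithTop ℕ∞) K ∧ Function.Injective K ∧ (∀ t, Function.Injective (mfderiv (𝓡 1) 𝓘(ℝ, EuclideanSpace ℝ (Fin 4)) K t)) ∧ ∀ t, ((∀ j : Fin 1, (1 : ℝ) ≤ (K t 0 - 4 * (((j : ℕ) : ℝ) + 1)) ^ 2 + (K t 1) ^ 2) ∧ ((K t 0) ^ 2 + (K t 1) ^ 2) / (40 * (((1 : ℕ) : ℝ) + 1)) ^ 2 + (∑ j : Fin 1, 1 / ((K t 0 - 4 * (((j : ℕ) : ℝ) + 1)) ^ 2 + (K t 1) ^ 2)) + (K t 2) ^ 2 + (K t 3) ^ 2 = 1)) ∧ (∃ (M : Type) (_ : TopologicalSpace M) (_ : T2Space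 M) (_ : SecondCountableTopology M) (_ : ChartedSpace (EuclideanSpace ℝ (Fin 4)) M) (_ : IsManifold (𝓡 4) ((⊤ : ℕ∞) : WithTop ℕ∞) M), Nonempty (M ≃ₕ (Metric.sphere (0 : EuclideanSpace ℝ (Fin 5)) 1)) ∧ ∃ (e : EuclideanSpace ℝ (Fin 4) → M) (f : EuclideanSpace ℝ (Fin 2) → M), (Manifold.IsSmoothEmbedding (𝓡 4) (𝓡 4) ((⊤ : ℕ∞) : WithTop ℕ∞) e ∧ ContMDiff (𝓡 2) (𝓡 4) ((⊤ : ℕ∞) : WithTop ℕ∞) f ∧ Set.InjOn f (Metric.closedBall (0 : EuclideanSpace ℝ (Fin 2)) 1) ∧ (∀ x ∈ Metric.closedBall (0 : EuclideanSpace ℝ (Fin 2)) 1, Function.Injective (mfderiv (𝓡 2) (𝓡 4) f x)) ∧ (∀ x : EuclideanSpace ℝ (Fin 2), ‖x‖ < 1 → f x ∉ e '' {x : EuclideanSpace ℝ (Fin 4) | (∀ j : Fin 1, (1 : ℝ) ≤ (x 0 - 4 * (((j : ℕ) : ℝ) + 1)) ^ 2 + (x 1) ^ 2) ∧ ((x 0)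 ^ 2 + (x 1) ^ 2) / (40 * (((1 : ℕ) : ℝ) + 1)) ^ 2 + (∑ j : Fin 1, 1 / ((x 0 - 4 * (((j : ℕ) : ℝ) + 1)) ^ 2 + (x 1) ^ 2)) + (x 2) ^ 2 + (x 3) ^ 2 ≤ 1}) ∧ ∀ t : (Metric.sphere (0 : EuclideanSpace ℝ (Fin 2)) 1), f t = e (K t))) ∧ ∀ (N : Type) [TopologicalSpace N] [T2Space N] [SecondCountableTopology N] [ChartedSpace (EuclideanSpace ℝ (Fin 4)) N] [IsManifold (𝓡 4) ((⊤ : ℕ∞) : WithTop ℕ∞) N], Nonempty (Diffeomorph (𝓡 4) (𝓡 4) N (Metric.sphere (0 : EuclideanSpace ℝ (Fin 5)) 1) ((⊤ : ℕ∞) : WithTop ℕ∞)) → ∀ (e' : EuclideanSpace ℝ (Fin 4) → N) (f' : EuclideanSpace ℝ (Fin 2) → N), ¬ (Manifold.IsSmoothEmbedding (𝓡 4) (𝓡 4) ((⊤ : ℕ∞) : WithTop ℕ∞) e' ∧ ContMDiff (𝓡 2) (𝓡 4) ((⊤ : ℕ∞) : WithTop ℕ∞) f' ∧ Set.InjOn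 f' (Metric.closedBall (0 : EuclideanSpace ℝ (Fin 2)) 1) ∧ (∀ x ∈ Metric.closedBall (0 : EuclideanSpace ℝ (Fin 2)) 1, Function.Injective (mfderiv (𝓡 2) (𝓡 4) f' x)) ∧ (∀ x : EuclideanSpace ℝ (Fin 2), ‖x‖ < 1 → f' x ∉ e' '' {x : EuclideanSpace ℝ (Fin 4) | (∀ j : Fin 1, (1 : ℝ) ≤ (x 0 - 4 * (((j : ℕ) : ℝ) + 1)) ^ 2 + (x 1) ^ 2) ∧ ((x 0) ^ 2 + (x 1) ^ 2) / (40 * (((1 : ℕ) : ℝ) + 1)) ^ 2 + (∑ j : Fin 1, 1 / ((x 0 - 4 * (((j : ℕ) : ℝ) + 1)) ^ 2 + (x 1) ^ 2)) + (x 2) ^ 2 + (x 3) ^ 2 ≤ 1}) ∧ ∀ t : (Metric.sphere (0 : EuclideanSpace ℝ (Fin 2)) 1), f' t = e' (K t))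

/-- item stmt-SmoothPoincare4-16119 · support · rank 9 · closed · proved by Summit.SmoothPoincare4.SmoothPoincare4.Theorems.DcrTransport_proof @ 39fef095299d (prover) · by planner
sources: Palais1960, tree: Literature.Topology.FourManifolds.Knot.IsSliceDiscIn (HomotopyBallSlice.lean, same disc predicate), Mathlib Diffeomorph (mfderiv as ContinuousLinearEquiv)
[support] TRANSPORT (provable now; the glue of `closes`): for every M (Statement binders) and every
diffeomorphism Φ : M ≅ S⁴, if (e, f) is an embedding/disc datum for (k, K₀) in M then (Φ∘e, Φ∘f) is
one in S⁴ — smooth embeddings, C^∞ maps, injectivity on the disc, injectivity of mfderiv (chain rule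
with the invertible mfderiv of Φ), disjointness of the open disc from the image of D_k (injectivity
of Φ) and the boundary identity are all preserved under composition with a diffeomorphism.
[difficulty: provable-now] -/
@[route_item "route-SmoothPoincare4-DottedCircleRasmussen"]
def DcrTransport : Prop :=
  ∀ (M : Type) [TopologicalSpace M] [T2Space M] [SecondCountableTopology M] [ChartedSpace (EuclideanSpace ℝ (Fin 4)) M] [IsManifold (𝓡 4) ((⊤ : ℕ∞) : WithTop ℕ∞) M], ∀ (Φ : Diffeomorph (𝓡 4) (𝓡 4) M (Metric.sphere (0 : EuclideanSpace ℝ (Fin 5)) 1) ((⊤ : ℕ∞) : WithTop ℕ∞)) (k : ℕ) (e : EuclideanSpace ℝ (Fin 4) → M) (K : (Metric.sphere (0 : EuclideanSpace ℝ (Fin 2)) 1) → EuclideanSpace ℝ (Fin 4)) (f : EuclideanSpace ℝ (Fin 2) → M), (Manifold.IsSmoothEmbedding (𝓡 4) (𝓡 4) ((⊤ : ℕ∞) : WithTop ℕ∞) e ∧ ContMDiff (𝓡 2) (𝓡 4) ((⊤ : ℕ∞) : WithTop ℕ∞) f ∧ Set.InjOn f (Metric.closedBall (0 : EuclideanSpace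 ℝ (Fin 2)) 1) ∧ (∀ x ∈ Metric.closedBall (0 : EuclideanSpace ℝ (Fin 2)) 1, Function.Injective (mfderiv (𝓡 2) (𝓡 4) f x)) ∧ (∀ x : EuclideanSpace ℝ (Fin 2), ‖x‖ < 1 → f x ∉ e '' {x : EuclideanSpace ℝ (Fin 4) | (∀ j : Fin k, (1 : ℝ) ≤ (x 0 - 4 * (((j : ℕ) : ℝ) + 1)) ^ 2 + (x 1) ^ 2) ∧ ((x 0) ^ 2 + (x 1) ^ 2) / (40 * (((k : ℕ) : ℝ) + 1)) ^ 2 + (∑ j : Fin k, 1 / ((x 0 - 4 * (((j : ℕ) : ℝ) + 1)) ^ 2 + (x 1) ^ 2)) + (x 2) ^ 2 + (x 3) ^ 2 ≤ 1}) ∧ ∀ t : (Metric.sphere (0 : EuclideanSpace ℝ (Fin 2)) 1), f t = e (K t)) → (Manifold.IsSmoothEmbedding (𝓡 4) (𝓡 4) ((⊤ : ℕ∞) : WithTop ℕ∞) (Φ ∘ e) ∧ ContMDiff (𝓡 2) (𝓡 4) ((⊤ : ℕ∞) : WithTop ℕ∞) (Φ ∘ f) ∧ Set.InjOn (Φ ∘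 f) (Metric.closedBall (0 : EuclideanSpace ℝ (Fin 2)) 1) ∧ (∀ x ∈ Metric.closedBall (0 : EuclideanSpace ℝ (Fin 2)) 1, Function.Injective (mfderiv (𝓡 2) (𝓡 4) (Φ ∘ f) x)) ∧ (∀ x : EuclideanSpace ℝ (Fin 2), ‖x‖ < 1 → (Φ ∘ f) x ∉ (Φ ∘ e) '' {x : EuclideanSpace ℝ (Fin 4) | (∀ j : Fin k, (1 : ℝ) ≤ (x 0 - 4 * (((j : ℕ) : ℝ) + 1)) ^ 2 + (x 1) ^ 2) ∧ ((x 0) ^ 2 + (x 1) ^ 2) / (40 * (((k : ℕ) : ℝ) + 1)) ^ 2 + (∑ j : Fin k, 1 / ((x 0 - 4 * (((j : ℕ) : ℝ) + 1)) ^ 2 + (x 1) ^ 2)) + (x 2) ^ 2 + (x 3) ^ 2 ≤ 1}) ∧ ∀ t : (Metric.sphere (0 : EuclideanSpace ℝ (Fin 2)) 1), (Φ ∘ f) t = (Φ ∘ e) (K t))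

/-- item stmt-SmoothPoincare4-16120 · support · rank 9 · closed · proved by Summit.SmoothPoincare4.SmoothPoincare4.Theorems.DcrRungGlue_proof @ e19c0e6628eb (prover) · by planner
sources: ManolescuMarengonSarkarWillis2023 §1 (r = 1 case), tree: this route's DcrGapOne/DcrGap
[support] GLUE (provable now, Sketch.lean `gapOne_imp_gap`): the k = 1 rung implies the target — a
gap witnessed with one dotted circle is a gap (instantiate k := 1). [difficulty: provable-now] -/
@[route_item "route-SmoothPoincare4-DottedCircleRasmussen"]
def DcrRungGlue : Prop :=
  DcrGapOne → DcrGap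

/-- item stmt-SmoothPoincare4-16153 · support · rank 9 · open · by planner
why it might fail: TRUE modulo Palais + general position + MMSW L8.19; the window s₋ ≤ 0 ≤ s₊ is invariant under the mirror/filling ambiguities, but a CHIRALITY swap in the vendored finiteApprox (k > 0 right-handed, Thm 1.4) exchanges s₋ ↔ s₊ and fails on Wh⁺ ⊂ S¹×S² (slice in B²×S², (s₋,s₊) = (0,2), MMSW Ex. 8.5).
sources: ManolescuMarengonSarkarWillis2023, Palais1960, Cerf1968, GompfStipsicz1999
[support] THE GFGMW LEMMA (generalised Freedman–Gompf–Morrison–Walker, provable from named facts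
once MMSWRasmussen lands): for every k, every model circle K₀ ⊂ ∂D_k null-homologous in ∂D_k ≅
#ᵏ(S¹×S²), and every smooth embedding e' : ℝ⁴ → S⁴ such that e'∘K₀ bounds a smooth proper disc in S⁴
∖ e'(D_k): s₋(K₀) ≤ 0 ≤ s₊(K₀). PROOF SKETCH: (1) Palais: e'|B_R (B_R ⊃ D_k) is ambient-isotopic to
the standard chart e₀ or to e₀∘r, r the reflection x₃ ↦ −x₃ (which preserves D_k); the reflection R
of S⁴ ⊂ ℝ⁵ in the corresponding hyperplane satisfies R∘e₀ = e₀∘r, so in either case BOTH e₀∘K₀ and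
e₀∘(r∘K₀) bound discs in P := S⁴ ∖ e₀(D̊_k); (2) P ≅ ♮ᵏ(B²×S²) with ∂P = e₀(∂D_k) (dotted-circle
calculus: S⁴ = (0∪1-handles) ∪ ♮ᵏ(B²×S²), GompfStipsicz1999 §5.4; D_k = B⁴ minus k flat proper discs
= ♮ᵏ(S¹×B³)); fix one diffeomorphism μ : ∂D_k → M_k^MMSW — any other differs by Diff(M_k), and
orientation-preserving ones do not change s (MMSW Thm 2.8), orientation-reversing ones are
m∘(orientation-preserving); (3) MMSW Lemma 8.19 with σ = ℓ = 1, g = 0: s₋ ≤ 0 for μK₀ and for μ r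
K₀; s₋(μ r K₀) = s(m(ψ μK₀)) = −s₊(μK₀). Hence s₋(K₀) ≤ 0 and s₊(K₀) ≥ 0. COROLLARY:
DcrRasmussenWitness → DcrGap (contraposit -/
@[route_item "route-SmoothPoincare4-DottedCircleRasmussen"]
def DcrGfgmw : Prop :=
  ∀ (k : ℕ) (K : (Metric.sphere (0 : EuclideanSpace ℝ (Fin 2)) 1) → EuclideanSpace ℝ (Fin 4)) (e' : EuclideanSpace ℝ (Fin 4) → (Metric.sphere (0 : EuclideanSpace ℝ (Fin 5)) 1)) (f' : EuclideanSpace ℝ (Fin 2) → (Metric.sphere (0 : EuclideanSpace ℝ (Fin 5)) 1)), Literature.Topology.FourManifolds.MMSW.IsSliceDiscInComplement k K (Metric.sphere (0 : EuclideanSpace ℝ (Fin 5)) 1) e' f' → ∀ w : Literature.Topology.FourManifolds.MMSWRasmussen k K, w.sMinus ≤ 0 ∧ 0 ≤ w.sPlus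

-- item stmt-SmoothPoincare4-16154 · support · rank 9 · open · by planner — informal only, no Lean statement yet:
--   [support] CALIBRATION (computation; forced identities, SPC4-independent): for every Kirby diagram
--   WITH 1-handles of a homotopy 4-sphere KNOWN to be standard — Gompf's 1991 presentation of the
--   Akbulut–Kirby sphere, the Cappell–Shaneson/Akbulut–Kirby presentations (standard by Akbulut 2010 /
--   Gompf 2010), Gompf–Scharlemann–Thompson's square-knot family after trading a 2-handle for a dotted
--   circle, Meier–Zupan generalised-square-knot spheres in the proved range — and every null-homologous
--   attaching circle K₀ (after slides) of its 2-handles: s₋(K₀) ≤ 0 ≤ s₊(K₀), computed as s(D(k⃗)) with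
--   k ≥ ⌈(n⁺+2

/-- item stmt-SmoothPoincare4-17020 · support · rank 9 · closed · proved by Summit.SmoothPoincare4.SmoothPoincare4.Theorems.DcrEngineGlue_proof @ a165a87818e1 (prover) · by planner
sources: tree: Theorems.DcrTransport_proof, ManolescuMarengonSarkarWillis2023
[support] ENGINE GLUE (provable now): a Rasmussen certificate plus the GFGMW window IS a one-handle
slice gap — DcrRasmussenWitness → DcrGfgmw → DcrGap. Proof (folder Sketch2.lean
`engineGlue_of_transport`, rc 0, from the PROVED transport support DcrTransport =
Theorems.DcrTransport_proof): take the witness (k, K₀, Σ, e, f, w with s₋ > 0 or s₊ < 0);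
`MMSW.isModelKnot_iff` and `MMSW.isSliceDiscInComplement_iff` (both Iff.rfl) turn its hypotheses
into DcrGap's literal binder block and slice datum; for the no-disc clause, a datum (e', f') in some
N with Φ : N ≅ S⁴ transports to (Φ∘e', Φ∘f') in the literal S⁴ (DcrTransport), where DcrGfgmw gives
s₋(K₀) ≤ 0 ≤ s₊(K₀) for w — contradiction (omega). This is the edge by which the engine crux (rank
2) feeds the sole binder DcrGap of `closes`; the audited cone cannot follow sufficient-condition
edges backwards, so the engine is connected through this item and the views cone, not as a
hypothesis. [difficulty: provable-now] -/
@[route_item "route-SmoothPoincare4-DottedCircleRasmussen"]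
def DcrEngineGlue : Prop :=
  DcrRasmussenWitness → DcrGfgmw → DcrGap

-- earlier Assembly (stmt-SmoothPoincare4-16121, replaced 2026-08-16T16:24:55Z -> stmt-SmoothPoincare4-16137): retired by None — (DcrGapOne → DcrGap) ∧ (DcrRigidity → ¬ DcrGap) ∧ (DcrGap → DcrTransport → ¬ SmoothPoincare4)
-- earlier Assembly (stmt-SmoothPoincare4-16137, replaced 2026-08-16T22:10:24Z -> stmt-SmoothPoincare4-17012): retired by None — (DcrGapOne → DcrGap) ∧ (DcrRigidity → ¬ DcrGap)
/-- item stmt-SmoothPoincare4-17012 · assembly · rank 1 · closed · proved by Summit.SmoothPoincare4.SmoothPoincare4.Theorems.DottedCircleRasmussen_Assembly_proof @ 2ac9e7165d7f (prover) · by planner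
sources: FreedmanGompfMorrisonWalker2010, Palais1960
[assembly] the route's frame (rev 2): the one-handle slice gap refutes the summit — the statement of
the deciding theorem `closes` itself (SPC4 makes the witnessing homotopy sphere M an admissible N ≅
S⁴, and the slice datum (e, f) contradicts the no-disc clause), hence provable now by `fun hX =>
closes hX` (folder Sketch.lean `assembly_holds`, rc 0). Around it: the kill switch is item
DcrRigidity = ¬DcrGap by name (the audited cone's kill path); the engine DcrRasmussenWitness feeds
DcrGap through the GFGMW window (support DcrGfgmw + glue); the k = 1 rung DcrGapOne (support,
special case) feeds it by instantiation (DcrRungGlue). The rev-1 frame (DcrGapOne → DcrGap) ∧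
(DcrRigidity → ¬DcrGap) is retired: its first conjunct is DcrRungGlue verbatim and its second
becomes an identity once DcrRigidity is ¬DcrGap by name. [difficulty: provable-now] -/
@[route_item "route-SmoothPoincare4-DottedCircleRasmussen"]
def Assembly : Prop :=
  DcrGap → ¬ _root_.SmoothPoincare4

/-! D-0027 §2.1 — DECIDING THEOREM (planner-authored via `route open/edit --closes-file`; by planner-plan-lens-SmoothPoincare4-negation-v2-0 2026-08-16T16:24:55Z):
its hypotheses are this route's items and its conclusion the sub-problem Statement (glue_lint), and it elaborates with this file. -/

@[closes "route-SmoothPoincare4-DottedCircleRasmussen"] theorem closes (hX : DcrGap) : ¬ SmoothPoincare4 := by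
  intro hS
  obtain ⟨k, K, hK, ⟨M, i1, i2, i3, i4, i5, ⟨h⟩, e, f, hf⟩, hno⟩ := hX
  exact @hno M i1 i2 i3 i4 i5 (hS M i4 i5 h) e f hf

end Summit.SmoothPoincare4.SmoothPoincare4.Theses.DottedCircleRasmussen
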